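import Literature.RingTheory.Flat.CohenMacaulayOverRegularFlat
import Mathlib.AlgebraicGeometry.Morphisms.Flat
import Mathlib.AlgebraicGeometry.Noetherian
import HarnessLib

/-!
# Flatness of a morphism from a Cohen–Macaulay scheme to a regular scheme from stalk dimensions and zero-dimensional fibres
# («miracle flatness», Matsumura Thm. 23.1 ∕ EGA IV₂ 6.1.5, stalkwise; the local step of [Lan2013, Lem. 6.3.1.11])

Topic `Literature/AlgebraicGeometry/Morphisms`; namespace `Literature.AlgebraicGeometry.Morphisms`.  THEOREMS ONLY.  Sequel of
★ `FlatOfRegularStalks` (`Flat.of_isRegularLocalRing_stalk`, REGULAR source) with the source only COHEN–MACAULAY, over the ring-level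
★ `RingTheory.Flat.flat_of_isCohenMacaulayLocalRing_of_maximalIdeal_pow_le`.

* `Flat.of_isCohenMacaulayLocalRing_stalk` — a morphism of schemes `f : X ⟶ Y` with `X` locally Noetherian is FLAT as soon as, at
  every `x ∈ X`: `𝒪_{X,x}` is Cohen–Macaulay (the tree's `Depth.IsCohenMacaulayLocalRing`), `𝒪_{Y,f x}` is regular, the two have
  the same Krull dimension, and `𝔪_{f x} 𝒪_{X,x}` contains a power of `𝔪_x` (the fibre of `f` through `x` is zero-dimensional at
  `x`).  Mathlib's `AlgebraicGeometry.Flat` is tested on stalk maps (`Flat.of_stalkMap`).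

This is the local-algebra content of [Lan2013PELCompactifications, Lem. 6.3.1.11] = [KatzMazur, Notes added in proof] («`f : Z₁ → Z₂`
quasi-finite between equidimensional locally noetherian schemes of the same dimension, `Z₁` Cohen–Macaulay, `Z₂` regular ⇒ `f`
flat»; typed as the named fact ★ `Lan2013.Sec631GoodFormalModels.Lan2013_63111_flat_of_quasiFinite`): what remains between the
two is dimension bookkeeping — quasi-finiteness gives the `𝔪`-primary fibre, and «equidimensional of the same dimension» with
`Z₂` regular (universally catenary) gives `dim 𝒪_{Z₁,z} = dim 𝒪_{Z₂,f z}` ([EGA IV₂ 5.4.1, 5.6.4, 5.6.5.3], as in the printed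
proof) — recorded here as the road to that fact's `…_holds`, not asserted.  HC_CM is proved only modulo the 7 printed citations
until rung 0 closes; nothing here changes that.

## References
* [Matsumura1987] H. Matsumura, *Commutative Ring Theory*, CUP 1986, Thm. 23.1.
* [Lan2013PELCompactifications] K.-W. Lan, *Arithmetic compactifications of PEL-type Shimura varieties*, Lem. 6.3.1.11 (p. 417).
-/

noncomputable section

open CategoryTheory AlgebraicGeometry IsLocalRing

universe u

namespace Literature.AlgebraicGeometry.Morphisms

open Literature.RingTheory.Depth (IsCohenMacaulayLocalRing)

/-- **Miracle flatness, stalkwise (Cohen–Macaulay source, regular target).**  Let `f : X ⟶ Y` be a morphism of schemes,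
`X` locally Noetherian, such that for every `x ∈ X` the local ring `𝒪_{X,x}` is Cohen–Macaulay, `𝒪_{Y,f x}` is regular of the
same Krull dimension, and some power of `𝔪_x` lies in `𝔪_{f x} 𝒪_{X,x}`.  Then `f` is flat: each stalk map
`𝒪_{Y,f x} → 𝒪_{X,x}` is a local homomorphism to which Matsumura 23.1 applies
(★ `Literature.RingTheory.Flat.flat_of_isCohenMacaulayLocalRing_of_maximalIdeal_pow_le`). [cite: Matsumura1987, Thm. 23.1] -/
theorem Flat.of_isCohenMacaulayLocalRing_stalk {X Y : Scheme.{u}} [IsLocallyNoetherian X] (f : X ⟶ Y)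
    (hX : ∀ x : X, IsCohenMacaulayLocalRing (X.presheaf.stalk x))
    (hY : ∀ x : X, IsRegularLocalRing (Y.presheaf.stalk (f.base x)))
    (hdim : ∀ x : X, ringKrullDim (X.presheaf.stalk x) = ringKrullDim (Y.presheaf.stalk (f.base x)))
    (hprim : ∀ x : X, ∃ N : ℕ, maximalIdeal (X.presheaf.stalk x) ^ N ≤
      (maximalIdeal (Y.presheaf.stalk (f.base x))).map (f.stalkMap x).hom) :
    Flat f := by
  refine Flat.of_stalkMap f fun x => ?_
  haveI := hY x
  letI : Algebra (Y.presheaf.stalk (f.base x)) (X.presheaf.stalk x) := (f.stalkMap x).hom.toAlgebra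
  haveI : IsLocalHom (algebraMap (Y.presheaf.stalk (f.base x)) (X.presheaf.stalk x)) :=
    inferInstanceAs (IsLocalHom (f.stalkMap x).hom)
  exact Literature.RingTheory.Flat.flat_of_isCohenMacaulayLocalRing_of_maximalIdeal_pow_le (hX x) (hdim x) (hprim x)

/-- The same with a regular target scheme stated pointwise on `Y` (every stalk of `Y` regular), the form in which
[Lan2013PELCompactifications, Lem. 6.3.1.11] carries its hypotheses. [cite: Matsumura1987, Thm. 23.1] -/
theorem Flat.of_isCohenMacaulayLocalRing_stalk' {X Y : Scheme.{u}} [IsLocallyNoetherian X] (f : X ⟶ Y)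
    (hX : ∀ x : X, IsCohenMacaulayLocalRing (X.presheaf.stalk x))
    (hY : ∀ y : Y, IsRegularLocalRing (Y.presheaf.stalk y))
    (hdim : ∀ x : X, ringKrullDim (X.presheaf.stalk x) = ringKrullDim (Y.presheaf.stalk (f.base x)))
    (hprim : ∀ x : X, ∃ N : ℕ, maximalIdeal (X.presheaf.stalk x) ^ N ≤
      (maximalIdeal (Y.presheaf.stalk (f.base x))).map (f.stalkMap x).hom) :
    Flat f :=
  Flat.of_isCohenMacaulayLocalRing_stalk f hX (fun x => hY (f.base x)) hdim hprim

end Literature.AlgebraicGeometry.Morphisms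

end
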